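import Summits.Ventures.CertifiedManyBodySolver.Downfold.EmeryClusterFloorSeamFilling
import Summits.Ventures.CertifiedManyBodySolver.Downfold.EmeryCuprateSigns
import Summits.Ventures.CertifiedManyBodySolver.Downfold.EmeryBoxesInfiniteLayer
import Literature.MathematicalPhysics.QuantumLattice.EmeryThreeBandCuO4ClusterDictionary
import Summits.Ventures.CertifiedManyBodySolver.Certificates.HubbardSquare_kgp1x5_SLCOx_c0_ll_mum118o10_G
import Summits.Ventures.CertifiedManyBodySolver.Certificates.HubbardSquare_kgp1x5_SLCOx_c1_hl_mum120o10_G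
import Summits.Ventures.CertifiedManyBodySolver.Certificates.HubbardSquare_kgp1x5_SLCOx_c2_lh_mum120o10_G
import Summits.Ventures.CertifiedManyBodySolver.Certificates.HubbardSquare_kgp1x5_SLCOx_c3_hh_mum122o10_G
import HarnessLib

/-!
# CERTIFIED THREE-BAND (EMERY) WORD: Sr₀.₉La₀.₁CuO₂ (#37) cGW-SIC CLASS six-box (electron-doped, EXTRAPOLATED) — `emeryBoxSLCOClass`:
# `e(emeryLine cuprateSigns ·, ρ = 51/40) ≥ 245880937/80000000 = 3.0735117 eV per lattice site` (= `12.2940469 eV per CuO₂`)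

Venture CertifiedManyBodySolver, cell `pub/hubbard-downfold` (S1 = ROUTER) × crew hubbard-fast S2 (iv) «three-band Emery boxes»; seat hubbard-downfold-mod-4
(S1/S2 Emery seam; closing file by the recipe `router/INFLATION-RULES-3to1-B.md` §B.38 (j), generator `hubbard-downfold-mod-4/floor-orders/make_word_file.py`).
Namespace `Summit.Ventures.CertifiedManyBodySolver.Downfold`.

THE CHAIN (kernel-checked, std axioms, 0 sorry): LAW + DICTIONARY + GLUE (hubbard-box-p1: `EmeryThreeBandClusterFloor`, `EmeryThreeBandStatesNonempty`,
`EmeryThreeBandCuO4ClusterDictionary` — `posSemidef_cuO4_uniform_add_zero_sub_of_gpSectorFloors`) · WINDOW + SEAM + SIGN + DOORS (this seat: `EmeryThreeBandCuO4WindowFloor`,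
`EmeryClusterFloorSeam(Free/Filling)`, `EmeryCuprateSigns`) · TABLES (this seat, `router/EMERY-FLOOR-ORDERS.tsv` row 55) · DEVICE + CERTIFICATES (hubbard-box-p2:
`Certificates/HubbardSquare_kgp1x5_{SLCOx_c0_ll_mum118o10, SLCOx_c1_hl_mum120o10, SLCOx_c2_lh_mum120o10, SLCOx_c3_hh_mum122o10}_{S0,S1,F,G}`, Q = 64000, mass M = 2, tilts μ = -59/5, -12, -12, -61/5,
certified levels q₀ = -381/4, -244038047/2500000, -60925293/625000, -998519063/10000000).

THE OBJECT: `emeryBoxSLCOClass` (`EmeryBoxesInfiniteLayer`; router/BOXES/SrLaCuO2.md): delivered six-box corners (t_pd | t_pp) ∈ {129/100, 34/25} × {37/50, 41/50},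
(ε_d, ε_p, U_d, U_p) = (21/10, 0, 222/25, 144/25) eV; n_holes ∈ [9/10, 9/10] ⇒ cell filling ρ ∈ [51/40, 51/40]. Grade of the object: EXTRAPOLATED (CLASS transfer on every entry).

THIS FILE: §0 the corner sheet `slcoClassCorner` (= `lowerCorner` of the delivered six-box); §1 per corner the tilted coupling vector, the three TABLE IDENTITIES (box-p2's
integer tables / Q = box-p1's `plusTau / plusUps / plusNu` at θᵢ, M = 2) and the `PosSemidef` certificate; §2 tilts / levels / `hq` / floor checks (corner lines
q₀ᵢ/8 − μᵢρ at ρ = 51/40: 3.13875 / 3.0981 / 3.11494 / 3.07351; minimum = corner 3); §3 **THE WORD** `emeryBoxSLCOClass_cuprate_energyFloor` + 4-dp reading;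
§4 the filling line `slcoClassFloorLine ρ = 61/5·ρ − 998519063/80000000` (corner 3's line, the envelope for ρ ∈ [0, 139/100]) and the fixed-ρ word on that range.

HONEST FRAMING: a CERTIFIED inequality on a EXTRAPOLATED (CLASS transfer on every entry) object (box ends are [float] literature / DFT with locators in `router/BOXES/SrLaCuO2.md`); a uniform-weight
single-CuO₄ Anderson floor — crude by construction; an ENERGY word — nothing about superconductivity, no phase sentence, no number of record at a router anchor moves;
INFL-3to1 stays screening-grade.
-/

noncomputable section

namespace Summit.Ventures.CertifiedManyBodySolver.Downfold

open NonemptyInterval Matrix Finset Literature.Probability.LatticeModels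
open Literature.MathematicalPhysics.QuantumLattice Literature.Computation.Certificates
open Summit.Ventures.CertifiedManyBodySolver.Certificates OccupationCode ClusterLowerBound
open scoped BigOperators ComplexOrder

/-! ## §0 The corner sheet -/

/-- **The floor order sheet of `emeryBoxSLCOClass`** (order `(t_pd, t_pp, ε_d, ε_p, U_d, U_p)`, eV, `εp = 0`): the four lower-face corners of its delivered six-box
(router/EMERY-FLOOR-ORDERS.tsv row 55). [folklore] -/
def slcoClassCorner : Fin 4 → Fin 6 → ℝ :=
  ![![129/100, 37/50, 21/10, 0, 222/25, 144/25], ![34/25, 37/50, 21/10, 0, 222/25, 144/25], ![129/100, 41/50, 21/10, 0, 222/25, 144/25], ![34/25, 41/50, 21/10, 0, 222/25, 144/25]]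

/-- The order sheet IS the lower-corner list of the delivered six-box. [folklore] -/
theorem slcoClass_lowerCorner :
    lowerCorner (emeryLo 0 slcoClassEmery_tpd slcoClassEmery_tpp slcoClassEmery_Delta slcoClassEmery_Udd slcoClassEmery_Upp) (emeryHi 0 slcoClassEmery_tpd slcoClassEmery_tpp slcoClassEmery_Delta slcoClassEmery_Udd slcoClassEmery_Upp) = slcoClassCorner := by
  ext i k
  fin_cases i <;> fin_cases k <;> simp [lowerCorner, slcoClassCorner, emeryLo, emeryHi, slcoClassEmery_tpd, slcoClassEmery_tpp, slcoClassEmery_Delta, slcoClassEmery_Udd, slcoClassEmery_Upp]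

/-! ## §1 The four corners: table identities and certificates -/

/-- The tilted coupling vector at corner 0 (`slcoClassCorner 0`, tilt `μ = -59/5`), explicitly. [folklore] -/
theorem slcoClassFloor_theta0 :
    emeryLine cuprateSigns (slcoClassCorner 0) + (-59/5 : ℝ) • levelDir =
      ![129/100, 129/100, 129/100, 129/100, -(37/50), -(37/50), -(37/50), -(37/50), 21/10 - 59/5, -(59/5), -(59/5), 222/25, 144/25, 144/25] := by
  rw [emeryLine_cuprateSigns]
  ext a
  fin_cases a <;> simp [slcoClassCorner, levelDir]
  all_goals norm_num

/-- **Table identity τ, corner 0**: box-p2's hopping table `symW W0 / 64000` IS `plusTau θ_0 2`. [cite: ValentiStolzeHirschfeld1991, §II] -/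
theorem slcoClassFloor_tau0 :
    (fun x y : Fin 1 ×ₗ Fin 5 => ((symW kgp1x5_SLCOx_c0_ll_mum118o10_W0 (siteRank x) (siteRank y) : ℤ) : ℝ) / (64000 : ℕ)) =
      plusTau (emeryLine cuprateSigns (slcoClassCorner 0) + (-59/5 : ℝ) • levelDir) 2 := by
  rw [slcoClassFloor_theta0]
  funext i j
  obtain ⟨⟨a, b⟩, rfl⟩ := toLex.surjective i
  obtain ⟨⟨c, d⟩, rfl⟩ := toLex.surjective j
  fin_cases a; fin_cases c
  fin_cases b <;> fin_cases d <;> simp [plusTau, symW, siteRank, kgp1x5_SLCOx_c0_ll_mum118o10_W0]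
  all_goals norm_num

/-- **Table identity υ, corner 0**: box-p2's repulsion table `V / 64000` IS `plusUps θ_0 2`. [cite: ValentiStolzeHirschfeld1991, §II] -/
theorem slcoClassFloor_ups0 :
    (fun x : Fin 1 ×ₗ Fin 5 => ((kgp1x5_SLCOx_c0_ll_mum118o10_V (siteRank x) : ℤ) : ℝ) / (64000 : ℕ)) =
      plusUps (emeryLine cuprateSigns (slcoClassCorner 0) + (-59/5 : ℝ) • levelDir) 2 := by
  rw [slcoClassFloor_theta0]
  funext i
  obtain ⟨⟨a, b⟩, rfl⟩ := toLex.surjective i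
  fin_cases a
  fin_cases b <;> simp [plusUps, siteRank, kgp1x5_SLCOx_c0_ll_mum118o10_V]
  all_goals norm_num

/-- **Table identity ν, corner 0**: box-p2's potential table `M / 64000` (tilt folded in) IS `plusNu θ_0 2`. [cite: ValentiStolzeHirschfeld1991, §II] -/
theorem slcoClassFloor_nu0 :
    (fun x : Fin 1 ×ₗ Fin 5 => ((kgp1x5_SLCOx_c0_ll_mum118o10_M (siteRank x) : ℤ) : ℝ) / (64000 : ℕ)) =
      plusNu (emeryLine cuprateSigns (slcoClassCorner 0) + (-59/5 : ℝ) • levelDir) 2 := by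
  rw [slcoClassFloor_theta0]
  funext i
  obtain ⟨⟨a, b⟩, rfl⟩ := toLex.surjective i
  fin_cases a
  fin_cases b <;> simp [plusNu, siteRank, kgp1x5_SLCOx_c0_ll_mum118o10_M]
  all_goals norm_num

/-- **The cluster certificate at corner 0**: `H^(w_2)_(W₅)[emeryInteraction θ_0] + 0 − q₀·1 ⪰ 0` with `q₀ = -381/4` — box-p2's kernel sector floors
`kgp1x5_SLCOx_c0_ll_mum118o10_floor_min` through box-p1's dictionary + glue. [cite: Anderson1951, eq. (2)] -/
theorem slcoClassFloor_hq0 :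
    ((⟨fun X => (uniformPeriodicWeight liebPeriods emeryCuO4Window 2 X : ℂ) •
        (emeryInteraction (emeryLine cuprateSigns (slcoClassCorner 0) + (-59/5 : ℝ) • levelDir)).Φ X⟩ : FermionInteraction 2).localHamiltonian emeryCuO4Window +
        (0 : FermionOp emeryCuO4Window) - ((-381/4 : ℝ) : ℂ) • (1 : FermionOp emeryCuO4Window)).PosSemidef := by
  refine posSemidef_cuO4_uniform_add_zero_sub_of_gpSectorFloors _ 2 fun k hk => ?_
  have h := kgp1x5_SLCOx_c0_ll_mum118o10_floor_min k hk
  rw [slcoClassFloor_tau0, slcoClassFloor_ups0, slcoClassFloor_nu0] at h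
  exact_mod_cast h

/-- The tilted coupling vector at corner 1 (`slcoClassCorner 1`, tilt `μ = -12`), explicitly. [folklore] -/
theorem slcoClassFloor_theta1 :
    emeryLine cuprateSigns (slcoClassCorner 1) + (-12 : ℝ) • levelDir =
      ![34/25, 34/25, 34/25, 34/25, -(37/50), -(37/50), -(37/50), -(37/50), 21/10 - 12, -(12), -(12), 222/25, 144/25, 144/25] := by
  rw [emeryLine_cuprateSigns]
  ext a
  fin_cases a <;> simp [slcoClassCorner, levelDir]
  all_goals norm_num

/-- **Table identity τ, corner 1**: box-p2's hopping table `symW W0 / 64000` IS `plusTau θ_1 2`. [cite: ValentiStolzeHirschfeld1991, §II] -/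
theorem slcoClassFloor_tau1 :
    (fun x y : Fin 1 ×ₗ Fin 5 => ((symW kgp1x5_SLCOx_c1_hl_mum120o10_W0 (siteRank x) (siteRank y) : ℤ) : ℝ) / (64000 : ℕ)) =
      plusTau (emeryLine cuprateSigns (slcoClassCorner 1) + (-12 : ℝ) • levelDir) 2 := by
  rw [slcoClassFloor_theta1]
  funext i j
  obtain ⟨⟨a, b⟩, rfl⟩ := toLex.surjective i
  obtain ⟨⟨c, d⟩, rfl⟩ := toLex.surjective j
  fin_cases a; fin_cases c
  fin_cases b <;> fin_cases d <;> simp [plusTau, symW, siteRank, kgp1x5_SLCOx_c1_hl_mum120o10_W0]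
  all_goals norm_num

/-- **Table identity υ, corner 1**: box-p2's repulsion table `V / 64000` IS `plusUps θ_1 2`. [cite: ValentiStolzeHirschfeld1991, §II] -/
theorem slcoClassFloor_ups1 :
    (fun x : Fin 1 ×ₗ Fin 5 => ((kgp1x5_SLCOx_c1_hl_mum120o10_V (siteRank x) : ℤ) : ℝ) / (64000 : ℕ)) =
      plusUps (emeryLine cuprateSigns (slcoClassCorner 1) + (-12 : ℝ) • levelDir) 2 := by
  rw [slcoClassFloor_theta1]
  funext i
  obtain ⟨⟨a, b⟩, rfl⟩ := toLex.surjective i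
  fin_cases a
  fin_cases b <;> simp [plusUps, siteRank, kgp1x5_SLCOx_c1_hl_mum120o10_V]
  all_goals norm_num

/-- **Table identity ν, corner 1**: box-p2's potential table `M / 64000` (tilt folded in) IS `plusNu θ_1 2`. [cite: ValentiStolzeHirschfeld1991, §II] -/
theorem slcoClassFloor_nu1 :
    (fun x : Fin 1 ×ₗ Fin 5 => ((kgp1x5_SLCOx_c1_hl_mum120o10_M (siteRank x) : ℤ) : ℝ) / (64000 : ℕ)) =
      plusNu (emeryLine cuprateSigns (slcoClassCorner 1) + (-12 : ℝ) • levelDir) 2 := by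
  rw [slcoClassFloor_theta1]
  funext i
  obtain ⟨⟨a, b⟩, rfl⟩ := toLex.surjective i
  fin_cases a
  fin_cases b <;> simp [plusNu, siteRank, kgp1x5_SLCOx_c1_hl_mum120o10_M]
  all_goals norm_num

/-- **The cluster certificate at corner 1**: `H^(w_2)_(W₅)[emeryInteraction θ_1] + 0 − q₀·1 ⪰ 0` with `q₀ = -244038047/2500000` — box-p2's kernel sector floors
`kgp1x5_SLCOx_c1_hl_mum120o10_floor_min` through box-p1's dictionary + glue. [cite: Anderson1951, eq. (2)] -/
theorem slcoClassFloor_hq1 :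
    ((⟨fun X => (uniformPeriodicWeight liebPeriods emeryCuO4Window 2 X : ℂ) •
        (emeryInteraction (emeryLine cuprateSigns (slcoClassCorner 1) + (-12 : ℝ) • levelDir)).Φ X⟩ : FermionInteraction 2).localHamiltonian emeryCuO4Window +
        (0 : FermionOp emeryCuO4Window) - ((-244038047/2500000 : ℝ) : ℂ) • (1 : FermionOp emeryCuO4Window)).PosSemidef := by
  refine posSemidef_cuO4_uniform_add_zero_sub_of_gpSectorFloors _ 2 fun k hk => ?_
  have h := kgp1x5_SLCOx_c1_hl_mum120o10_floor_min k hk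
  rw [slcoClassFloor_tau1, slcoClassFloor_ups1, slcoClassFloor_nu1] at h
  exact_mod_cast h

/-- The tilted coupling vector at corner 2 (`slcoClassCorner 2`, tilt `μ = -12`), explicitly. [folklore] -/
theorem slcoClassFloor_theta2 :
    emeryLine cuprateSigns (slcoClassCorner 2) + (-12 : ℝ) • levelDir =
      ![129/100, 129/100, 129/100, 129/100, -(41/50), -(41/50), -(41/50), -(41/50), 21/10 - 12, -(12), -(12), 222/25, 144/25, 144/25] := by
  rw [emeryLine_cuprateSigns]
  ext a
  fin_cases a <;> simp [slcoClassCorner, levelDir]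
  all_goals norm_num

/-- **Table identity τ, corner 2**: box-p2's hopping table `symW W0 / 64000` IS `plusTau θ_2 2`. [cite: ValentiStolzeHirschfeld1991, §II] -/
theorem slcoClassFloor_tau2 :
    (fun x y : Fin 1 ×ₗ Fin 5 => ((symW kgp1x5_SLCOx_c2_lh_mum120o10_W0 (siteRank x) (siteRank y) : ℤ) : ℝ) / (64000 : ℕ)) =
      plusTau (emeryLine cuprateSigns (slcoClassCorner 2) + (-12 : ℝ) • levelDir) 2 := by
  rw [slcoClassFloor_theta2]
  funext i j
  obtain ⟨⟨a, b⟩, rfl⟩ := toLex.surjective i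
  obtain ⟨⟨c, d⟩, rfl⟩ := toLex.surjective j
  fin_cases a; fin_cases c
  fin_cases b <;> fin_cases d <;> simp [plusTau, symW, siteRank, kgp1x5_SLCOx_c2_lh_mum120o10_W0]
  all_goals norm_num

/-- **Table identity υ, corner 2**: box-p2's repulsion table `V / 64000` IS `plusUps θ_2 2`. [cite: ValentiStolzeHirschfeld1991, §II] -/
theorem slcoClassFloor_ups2 :
    (fun x : Fin 1 ×ₗ Fin 5 => ((kgp1x5_SLCOx_c2_lh_mum120o10_V (siteRank x) : ℤ) : ℝ) / (64000 : ℕ)) =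
      plusUps (emeryLine cuprateSigns (slcoClassCorner 2) + (-12 : ℝ) • levelDir) 2 := by
  rw [slcoClassFloor_theta2]
  funext i
  obtain ⟨⟨a, b⟩, rfl⟩ := toLex.surjective i
  fin_cases a
  fin_cases b <;> simp [plusUps, siteRank, kgp1x5_SLCOx_c2_lh_mum120o10_V]
  all_goals norm_num

/-- **Table identity ν, corner 2**: box-p2's potential table `M / 64000` (tilt folded in) IS `plusNu θ_2 2`. [cite: ValentiStolzeHirschfeld1991, §II] -/
theorem slcoClassFloor_nu2 :
    (fun x : Fin 1 ×ₗ Fin 5 => ((kgp1x5_SLCOx_c2_lh_mum120o10_M (siteRank x) : ℤ) : ℝ) / (64000 : ℕ)) =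
      plusNu (emeryLine cuprateSigns (slcoClassCorner 2) + (-12 : ℝ) • levelDir) 2 := by
  rw [slcoClassFloor_theta2]
  funext i
  obtain ⟨⟨a, b⟩, rfl⟩ := toLex.surjective i
  fin_cases a
  fin_cases b <;> simp [plusNu, siteRank, kgp1x5_SLCOx_c2_lh_mum120o10_M]
  all_goals norm_num

/-- **The cluster certificate at corner 2**: `H^(w_2)_(W₅)[emeryInteraction θ_2] + 0 − q₀·1 ⪰ 0` with `q₀ = -60925293/625000` — box-p2's kernel sector floors
`kgp1x5_SLCOx_c2_lh_mum120o10_floor_min` through box-p1's dictionary + glue. [cite: Anderson1951, eq. (2)] -/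
theorem slcoClassFloor_hq2 :
    ((⟨fun X => (uniformPeriodicWeight liebPeriods emeryCuO4Window 2 X : ℂ) •
        (emeryInteraction (emeryLine cuprateSigns (slcoClassCorner 2) + (-12 : ℝ) • levelDir)).Φ X⟩ : FermionInteraction 2).localHamiltonian emeryCuO4Window +
        (0 : FermionOp emeryCuO4Window) - ((-60925293/625000 : ℝ) : ℂ) • (1 : FermionOp emeryCuO4Window)).PosSemidef := by
  refine posSemidef_cuO4_uniform_add_zero_sub_of_gpSectorFloors _ 2 fun k hk => ?_
  have h := kgp1x5_SLCOx_c2_lh_mum120o10_floor_min k hk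
  rw [slcoClassFloor_tau2, slcoClassFloor_ups2, slcoClassFloor_nu2] at h
  exact_mod_cast h

/-- The tilted coupling vector at corner 3 (`slcoClassCorner 3`, tilt `μ = -61/5`), explicitly. [folklore] -/
theorem slcoClassFloor_theta3 :
    emeryLine cuprateSigns (slcoClassCorner 3) + (-61/5 : ℝ) • levelDir =
      ![34/25, 34/25, 34/25, 34/25, -(41/50), -(41/50), -(41/50), -(41/50), 21/10 - 61/5, -(61/5), -(61/5), 222/25, 144/25, 144/25] := by
  rw [emeryLine_cuprateSigns]
  ext a
  fin_cases a <;> simp [slcoClassCorner, levelDir]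
  all_goals norm_num

/-- **Table identity τ, corner 3**: box-p2's hopping table `symW W0 / 64000` IS `plusTau θ_3 2`. [cite: ValentiStolzeHirschfeld1991, §II] -/
theorem slcoClassFloor_tau3 :
    (fun x y : Fin 1 ×ₗ Fin 5 => ((symW kgp1x5_SLCOx_c3_hh_mum122o10_W0 (siteRank x) (siteRank y) : ℤ) : ℝ) / (64000 : ℕ)) =
      plusTau (emeryLine cuprateSigns (slcoClassCorner 3) + (-61/5 : ℝ) • levelDir) 2 := by
  rw [slcoClassFloor_theta3]
  funext i j
  obtain ⟨⟨a, b⟩, rfl⟩ := toLex.surjective i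
  obtain ⟨⟨c, d⟩, rfl⟩ := toLex.surjective j
  fin_cases a; fin_cases c
  fin_cases b <;> fin_cases d <;> simp [plusTau, symW, siteRank, kgp1x5_SLCOx_c3_hh_mum122o10_W0]
  all_goals norm_num

/-- **Table identity υ, corner 3**: box-p2's repulsion table `V / 64000` IS `plusUps θ_3 2`. [cite: ValentiStolzeHirschfeld1991, §II] -/
theorem slcoClassFloor_ups3 :
    (fun x : Fin 1 ×ₗ Fin 5 => ((kgp1x5_SLCOx_c3_hh_mum122o10_V (siteRank x) : ℤ) : ℝ) / (64000 : ℕ)) =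
      plusUps (emeryLine cuprateSigns (slcoClassCorner 3) + (-61/5 : ℝ) • levelDir) 2 := by
  rw [slcoClassFloor_theta3]
  funext i
  obtain ⟨⟨a, b⟩, rfl⟩ := toLex.surjective i
  fin_cases a
  fin_cases b <;> simp [plusUps, siteRank, kgp1x5_SLCOx_c3_hh_mum122o10_V]
  all_goals norm_num

/-- **Table identity ν, corner 3**: box-p2's potential table `M / 64000` (tilt folded in) IS `plusNu θ_3 2`. [cite: ValentiStolzeHirschfeld1991, §II] -/
theorem slcoClassFloor_nu3 :
    (fun x : Fin 1 ×ₗ Fin 5 => ((kgp1x5_SLCOx_c3_hh_mum122o10_M (siteRank x) : ℤ) : ℝ) / (64000 : ℕ)) =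
      plusNu (emeryLine cuprateSigns (slcoClassCorner 3) + (-61/5 : ℝ) • levelDir) 2 := by
  rw [slcoClassFloor_theta3]
  funext i
  obtain ⟨⟨a, b⟩, rfl⟩ := toLex.surjective i
  fin_cases a
  fin_cases b <;> simp [plusNu, siteRank, kgp1x5_SLCOx_c3_hh_mum122o10_M]
  all_goals norm_num

/-- **The cluster certificate at corner 3**: `H^(w_2)_(W₅)[emeryInteraction θ_3] + 0 − q₀·1 ⪰ 0` with `q₀ = -998519063/10000000` — box-p2's kernel sector floors
`kgp1x5_SLCOx_c3_hh_mum122o10_floor_min` through box-p1's dictionary + glue. [cite: Anderson1951, eq. (2)] -/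
theorem slcoClassFloor_hq3 :
    ((⟨fun X => (uniformPeriodicWeight liebPeriods emeryCuO4Window 2 X : ℂ) •
        (emeryInteraction (emeryLine cuprateSigns (slcoClassCorner 3) + (-61/5 : ℝ) • levelDir)).Φ X⟩ : FermionInteraction 2).localHamiltonian emeryCuO4Window +
        (0 : FermionOp emeryCuO4Window) - ((-998519063/10000000 : ℝ) : ℂ) • (1 : FermionOp emeryCuO4Window)).PosSemidef := by
  refine posSemidef_cuO4_uniform_add_zero_sub_of_gpSectorFloors _ 2 fun k hk => ?_
  have h := kgp1x5_SLCOx_c3_hh_mum122o10_floor_min k hk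
  rw [slcoClassFloor_tau3, slcoClassFloor_ups3, slcoClassFloor_nu3] at h
  exact_mod_cast h

/-! ## §2 Tilts, levels, and the door's hypotheses -/

/-- The four tilts `μ = (-59/5, -12, -12, -61/5)` eV (box-p2's float scan). [folklore] -/
def slcoClassFloor_mu : Fin 4 → ℝ := ![-59/5, -12, -12, -61/5]

/-- The four certified cluster levels `q₀ = (-381/4, -244038047/2500000, -60925293/625000, -998519063/10000000)` (cluster units = eV at mass 2). [folklore] -/
def slcoClassFloor_q0 : Fin 4 → ℝ := ![-381/4, -244038047/2500000, -60925293/625000, -998519063/10000000]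

/-- **All four certificates** in the shape of the door's `hq` (corners as `slcoClassCorner`). [cite: Anderson1951, eq. (2)] -/
theorem slcoClassFloor_hq : ∀ i : Fin 4,
    ((⟨fun X => (uniformPeriodicWeight liebPeriods emeryCuO4Window 2 X : ℂ) •
        (emeryInteraction (emeryLine cuprateSigns (slcoClassCorner i) + slcoClassFloor_mu i • levelDir)).Φ X⟩ : FermionInteraction 2).localHamiltonian emeryCuO4Window +
        (fun _ : Fin 4 => (0 : FermionOp emeryCuO4Window)) i - ((slcoClassFloor_q0 i : ℝ) : ℂ) • (1 : FermionOp emeryCuO4Window)).PosSemidef := by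
  intro i
  fin_cases i
  · simpa [slcoClassFloor_mu, slcoClassFloor_q0] using slcoClassFloor_hq0
  · simpa [slcoClassFloor_mu, slcoClassFloor_q0] using slcoClassFloor_hq1
  · simpa [slcoClassFloor_mu, slcoClassFloor_q0] using slcoClassFloor_hq2
  · simpa [slcoClassFloor_mu, slcoClassFloor_q0] using slcoClassFloor_hq3

/-- **The same certificates at the door's corner spelling** `lowerCorner (emeryLo 0 …) (emeryHi 0 …) i`. [cite: Anderson1951, eq. (2)] -/
theorem slcoClassFloor_hq_lowerCorner : ∀ i : Fin 4,
    ((⟨fun X => (uniformPeriodicWeight liebPeriods emeryCuO4Window 2 X : ℂ) •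
        (emeryInteraction (emeryLine cuprateSigns (lowerCorner (emeryLo 0 slcoClassEmery_tpd slcoClassEmery_tpp slcoClassEmery_Delta slcoClassEmery_Udd slcoClassEmery_Upp)
          (emeryHi 0 slcoClassEmery_tpd slcoClassEmery_tpp slcoClassEmery_Delta slcoClassEmery_Udd slcoClassEmery_Upp) i) + slcoClassFloor_mu i • levelDir)).Φ X⟩ :
          FermionInteraction 2).localHamiltonian emeryCuO4Window +
        (fun _ : Fin 4 => (0 : FermionOp emeryCuO4Window)) i - ((slcoClassFloor_q0 i : ℝ) : ℂ) • (1 : FermionOp emeryCuO4Window)).PosSemidef := by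
  rw [slcoClass_lowerCorner]
  exact slcoClassFloor_hq

/-- **The corner floors at the filling of record ρ = 51/40**: `q₀ᵢ/8 − μᵢ·ρ = 3.13875 / 3.0981 / 3.11494 / 3.07351` all dominate `245880937/80000000` (corner 3). [folklore] -/
theorem slcoClassFloor_hm : ∀ i : Fin 4, (245880937/80000000 : ℝ) ≤ slcoClassFloor_q0 i / (4 * 2) - slcoClassFloor_mu i * (51/40 : ℝ) := by
  intro i
  fin_cases i <;> simp [slcoClassFloor_mu, slcoClassFloor_q0] <;> norm_num

/-! ## §3 THE WORD -/

/-- **THE CERTIFIED THREE-BAND WORD on `emeryBoxSLCOClass`** (Sr₀.₉La₀.₁CuO₂ (#37) cGW-SIC CLASS six-box (electron-doped, EXTRAPOLATED)): with the cuprate sign pattern, at the cell filling of record ρ = 51/40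
(`n_holes = 9/10`), the variational ground-state energy density of the decorated three-band model is AT LEAST `245880937/80000000 = 3.0735117` eV per lattice site
(`12.2940469` eV per CuO₂) — everywhere on the box. Hypothesis-free. [cite: Anderson1951, eq. (2)] [cite: Israel1979, Thm. I.3.4] -/
theorem emeryBoxSLCOClass_cuprate_energyFloor :
    HoldsOn (fun p : EmeryCoord → ℝ =>
      (245880937/80000000 : ℝ) ≤ emeryEnergyDensity (emeryLine cuprateSigns (emeryLineCoords 0 p)) (51/40 : ℝ)) emeryBoxSLCOClass := by
  have h := holdsOn_emeryEnergyFloor_of_cuO4Certificates_free (E := emeryBoxSLCOClass) (εp := 0) (eA := slcoClassEmery_tpd) (eB := slcoClassEmery_tpp)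
    (eD := slcoClassEmery_Delta) (eUd := slcoClassEmery_Udd) (eUp := slcoClassEmery_Upp) rfl rfl rfl rfl rfl cuprateSigns (ρ := 51/40) (by norm_num) (by norm_num) (M := 2) two_pos
    (fun _ => 0) (fun _ ω' _ => re_expect_zero_cuO4 ω') slcoClassFloor_mu slcoClassFloor_q0 slcoClassFloor_hq_lowerCorner slcoClassFloor_hm
  simpa using h

/-- **Reading at 4 dp**: `e ≥ 3.0735` eV per lattice site. [cite: Anderson1951, eq. (2)] -/
theorem emeryBoxSLCOClass_cuprate_energyFloor_ge_4dp :
    HoldsOn (fun p : EmeryCoord → ℝ =>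
      (30735 / 10000 : ℝ) ≤ emeryEnergyDensity (emeryLine cuprateSigns (emeryLineCoords 0 p)) (51/40 : ℝ)) emeryBoxSLCOClass :=
  fun p hp => le_trans (by norm_num) (emeryBoxSLCOClass_cuprate_energyFloor p hp)

/-! ## §4 The filling line -/

/-- **The filling line of `emeryBoxSLCOClass`**: `61/5·ρ − 998519063/80000000` eV per lattice site = corner 3's tilted line `q₀/8 − μ·ρ` (μ = -61/5). [folklore] -/
def slcoClassFloorLine (ρ : ℝ) : ℝ := 61/5 * ρ - 998519063/80000000

/-- **The line is the lower envelope of the four corner lines for `ρ ∈ [0, 139/100]`.** [folklore] -/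
theorem slcoClassFloorLine_le_corner (i : Fin 4) {ρ : ℝ} (hρb : ρ ≤ (139/100 : ℝ)) :
    slcoClassFloorLine ρ ≤ slcoClassFloor_q0 i / (4 * 2) - slcoClassFloor_mu i * ρ := by
  unfold slcoClassFloorLine
  fin_cases i <;> simp [slcoClassFloor_q0, slcoClassFloor_mu] <;> nlinarith [hρb]

/-- **THE FILLING-LINE WORD on `emeryBoxSLCOClass`**: for every fixed filling `ρ ∈ [0, 139/100]`, `e(emeryLine cuprateSigns (emeryLineCoords 0 p), ρ) ≥ slcoClassFloorLine ρ` on the whole box.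
[cite: Anderson1951, eq. (2)] [cite: Israel1979, Thm. I.3.4] -/
theorem emeryBoxSLCOClass_cuprate_energyFloorLine {ρ : ℝ} (hρ0 : 0 ≤ ρ) (hρb : ρ ≤ (139/100 : ℝ)) :
    HoldsOn (fun p : EmeryCoord → ℝ =>
      slcoClassFloorLine ρ ≤ emeryEnergyDensity (emeryLine cuprateSigns (emeryLineCoords 0 p)) ρ) emeryBoxSLCOClass := by
  have h := holdsOn_emeryEnergyFloor_of_cuO4Certificates_free (E := emeryBoxSLCOClass) (εp := 0) (eA := slcoClassEmery_tpd) (eB := slcoClassEmery_tpp)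
    (eD := slcoClassEmery_Delta) (eUd := slcoClassEmery_Udd) (eUp := slcoClassEmery_Upp) rfl rfl rfl rfl rfl cuprateSigns hρ0 (hρb.trans (by norm_num)) (M := 2) two_pos
    (fun _ => 0) (fun _ ω' _ => re_expect_zero_cuO4 ω') slcoClassFloor_mu slcoClassFloor_q0 slcoClassFloor_hq_lowerCorner (fun i => slcoClassFloorLine_le_corner i hρb)
  simpa using h

end Summit.Ventures.CertifiedManyBodySolver.Downfold

end
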